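import Literature.Analysis.FluidPDE.AdaptedBackwardKernel
import Literature.Analysis.FluidPDE.WholeSpaceIBP
import Literature.Analysis.FluidPDE.SpaceTimeCalculus
import HarnessLib

/-!
# Kernel calculus: the first variation of `∫ q G` against a flow-adapted backward kernel
# (route `AdaptedFrequency`, item `TangentFlowTransfer`, stmt-NavierStokesRegularity-10494)

Helper file (all results proved). The point of a flow-adapted backward kernel `G` of
`∂ₜ + u·∇ − νΔ` (`Literature.Analysis.FluidPDE.IsAdaptedBackwardKernel`: `∂ₜG + u·∇G + νΔG = 0`,
`div u = 0`) is the identity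

  `d/dt ∫ q(t, x) G(t, x) dx = ∫ (∂ₜq + u·∇q − νΔq)(t, x) G(t, x) dx`

for nice scalar fields `q` — transport drops out of the first variation exactly (Friedman 1964,
Ch. 1 §8, (8.3)–(8.5): Green's identity `v L u − u L* v = Σ ∂ᵢ(…) − ∂ₜ(u v)` for the adjoint pair
`L = νΔ − u·∇ − ∂ₜ`, `L* = νΔ + div(u ·) + ∂ₜ`). The route uses it with `q = ‖curl u‖²` (adapted
enstrophy `H`) and the item `TangentFlowTransfer` needs it to know that `H` is differentiable with
the displayed derivative (so that `H_k′ → H̄′` can be passed to the blow-up limit). This file proves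
the identity for test fields `q` that are jointly `C²` on an open time set and supported in a fixed
compact set in space — the form from which the global one follows by a cut-off `χ_R → 1` once
derivative bounds on the solution are available. Only the regularity the kernel clauses provide is
used (`G` jointly `C²`; no bounds on `∇G`, `ΔG`: both derivatives are moved onto `q`).

* `hasDerivAt_integral_of_contDiffOn_of_support_subset`: differentiation under the integral sign
  for jointly `C¹` fields with uniformly compact spatial support (the tree's
  `hasDerivAt_integral_of_support_subset` assumes `C^∞`);
* `integral_mul_fderiv_apply_eq_neg_of_divergence_eq_zero`: `∫ q (b·∇G) = −∫ G (b·∇q)` for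
  `div b = 0`, `q ∈ C¹_c` (Leray 1934 §6 (1.11), via the tree's
  `integral_mul_divergence_add_eq_zero_left`);
* `integral_mul_laplacian_eq_integral_laplacian_mul`: `∫ q ΔG = ∫ (Δq) G` for `q ∈ C²_c`, `G ∈ C²`
  (Green's second identity without boundary, twice the tree's `integral_inner_laplacian_add_eq_zero`);
* `hasDerivAt_integral_mul_adaptedKernel`: **the first-variation identity** above.

References: A. Friedman, *Partial Differential Equations of Parabolic Type* (1964), Ch. 1 §8;
J. Leray, Acta Math. 63 (1934), §6 (1.11); P. Constantin, G. Iyer, CPAM 61 (2008), §2.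
-/

noncomputable section

open MeasureTheory Set Function Filter TopologicalSpace Metric
open scoped Topology NNReal ENNReal InnerProductSpace Laplacian RealInnerProductSpace

namespace Summit.NavierStokesRegularity.NavierStokesRegularity.Theorems

open Literature.Analysis Literature.Analysis.FluidPDE

/-! ### Differentiation under the integral sign for jointly `C¹` fields -/

section Parametric

variable {X : Type*} [NormedAddCommGroup X] [NormedSpace ℝ X] [MeasurableSpace X]
  [OpensMeasurableSpace X]
variable {F : Type*} [NormedAddCommGroup F] [NormedSpace ℝ F]
variable {μ : Measure X} [IsLocallyFiniteMeasure μ]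

omit [MeasurableSpace X] [OpensMeasurableSpace X] in
/-- Slices of a field that is jointly `Cⁿ` on `S × X` are `Cⁿ`. [folklore] -/
theorem contDiff_slice_of_contDiffOn_prod_univ {n : WithTop ℕ∞} {Φ : ℝ → X → F} {S : Set ℝ}
    (h : ContDiffOn ℝ n (uncurry Φ) (S ×ˢ univ)) {t : ℝ} (ht : t ∈ S) : ContDiff ℝ n (Φ t) := by
  have hc : ContDiff ℝ n (fun x : X => ((t, x) : ℝ × X)) := contDiff_const.prodMk contDiff_id
  have := h.comp_contDiff hc (fun x => mk_mem_prod ht (mem_univ x))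
  simpa [Function.comp_def] using this

omit [NormedSpace ℝ X] [NormedSpace ℝ F] [MeasurableSpace X] [OpensMeasurableSpace X] in
/-- Slices of a field that is jointly continuous on `S × X` are continuous. [folklore] -/
theorem continuous_slice_of_continuousOn_prod_univ {Φ : ℝ → X → F} {S : Set ℝ}
    (h : ContinuousOn (uncurry Φ) (S ×ˢ univ)) {t : ℝ} (ht : t ∈ S) : Continuous (Φ t) := by
  have := h.comp_continuous (continuous_const.prodMk continuous_id)
    (fun x => mk_mem_prod ht (mem_univ x))
  simpa [Function.comp_def] using this

omit [MeasurableSpace X] [OpensMeasurableSpace X] in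
/-- On an open time set, the time lines of a jointly `C¹` field are differentiable, with
derivative the joint derivative applied to `(1, 0)`. [folklore] -/
theorem hasDerivAt_timeLine_of_contDiffOn {n : WithTop ℕ∞} {Φ : ℝ → X → F} {S : Set ℝ}
    (hS : IsOpen S) (h : ContDiffOn ℝ n (uncurry Φ) (S ×ˢ univ)) (hn : 1 ≤ n) {t : ℝ} (ht : t ∈ S)
    (x : X) : HasDerivAt (fun s => Φ s x) (fderiv ℝ (uncurry Φ) (t, x) (1, 0)) t := by
  have hU : S ×ˢ (univ : Set X) ∈ 𝓝 (t, x) := (hS.prod isOpen_univ).mem_nhds ⟨ht, mem_univ x⟩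
  have hd : DifferentiableAt ℝ (uncurry Φ) (t, x) :=
    (h.contDiffAt hU).differentiableAt (zero_lt_one.trans_le hn).ne'
  exact hasDerivAt_timeLine hd.hasFDerivAt

omit [MeasurableSpace X] [OpensMeasurableSpace X] in
/-- On an open time set, the time derivative field `(s, x) ↦ ∂ₛΦ(s, x)` of a jointly `C¹` field
is jointly continuous. [folklore] -/
theorem continuousOn_deriv_timeLine_of_contDiffOn {n : WithTop ℕ∞} {Φ : ℝ → X → F} {S : Set ℝ}
    (hS : IsOpen S) (h : ContDiffOn ℝ n (uncurry Φ) (S ×ˢ univ)) (hn : 1 ≤ n) :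
    ContinuousOn (uncurry fun s x => deriv (fun r => Φ r x) s) (S ×ˢ univ) := by
  have hU : IsOpen (S ×ˢ (univ : Set X)) := hS.prod isOpen_univ
  have hcont : ContinuousOn (fun z : ℝ × X => fderiv ℝ (uncurry Φ) z (1, 0)) (S ×ˢ univ) :=
    (h.continuousOn_fderiv_of_isOpen hU hn).clm_apply continuousOn_const
  refine hcont.congr fun z hz => ?_
  obtain ⟨s, x⟩ := z
  exact (hasDerivAt_timeLine_of_contDiffOn hS h hn hz.1 x).deriv

/-- **Differentiation under the integral sign** for jointly `C¹` fields with uniformly compact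
spatial support: if `Φ` is jointly `C¹` on an open time set `S` and the slices `Φ t`, `t ∈ S`, are
supported in a fixed compact set `K`, then for `t ∈ S`, `d/dt ∫ Φ t x ∂μ = ∫ ∂ₜΦ(t, x) ∂μ`
(Mathlib `hasDerivAt_integral_of_dominated_loc_of_deriv_le`, dominated on a compact
time-neighbourhood by the maximum of the continuous `∂ₜΦ` on `[t − δ, t + δ] × K`; the tree's
`hasDerivAt_integral_of_support_subset` is the `C^∞` case; Evans 2010, §7.1.2 (b)). [folklore] -/
theorem hasDerivAt_integral_of_contDiffOn_of_support_subset [CompleteSpace F]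
    [SecondCountableTopologyEither X F] {n : WithTop ℕ∞} {Φ : ℝ → X → F} {S : Set ℝ}
    (hS : IsOpen S) (hΦ : ContDiffOn ℝ n (uncurry Φ) (S ×ˢ univ)) (hn : 1 ≤ n) {K : Set X}
    (hK : IsCompact K) (hsupp : ∀ t ∈ S, ∀ x ∉ K, Φ t x = 0) {t : ℝ} (ht : t ∈ S) :
    HasDerivAt (fun s => ∫ x, Φ s x ∂μ) (∫ x, deriv (fun s => Φ s x) t ∂μ) t := by
  -- a compact time-neighbourhood `[t - δ/2, t + δ/2] ⊆ S`
  obtain ⟨δ, hδ, hball⟩ := Metric.isOpen_iff.1 hS t ht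
  have hIcc : Icc (t - δ / 2) (t + δ / 2) ⊆ S := fun s hs => hball <| by
    rw [Metric.mem_ball, Real.dist_eq, abs_lt]
    constructor <;> linarith [hs.1, hs.2]
  have hnhds : Icc (t - δ / 2) (t + δ / 2) ∈ 𝓝 t := Icc_mem_nhds (by linarith) (by linarith)
  -- the time derivative field and its continuity
  set Φ' : ℝ → X → F := fun s x => deriv (fun r => Φ r x) s with hΦ'
  have hΦ'cont : ContinuousOn (uncurry Φ') (S ×ˢ univ) :=
    continuousOn_deriv_timeLine_of_contDiffOn hS hΦ hn
  -- slices are continuous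
  have hslice : ∀ s ∈ S, Continuous (Φ s) := fun s hs =>
    continuous_slice_of_continuousOn_prod_univ hΦ.continuousOn hs
  have hslice' : ∀ s ∈ S, Continuous (Φ' s) := fun s hs =>
    continuous_slice_of_continuousOn_prod_univ hΦ'cont hs
  -- `Φ' s x = 0` off `K`
  have hsupp' : ∀ s ∈ S, ∀ x ∉ K, Φ' s x = 0 := by
    intro s hs x hx
    have : (fun r => Φ r x) =ᶠ[𝓝 s] fun _ => (0 : F) := by
      filter_upwards [hS.mem_nhds hs] with r hr using hsupp r hr x hx
    show deriv (fun r => Φ r x) s = 0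
    rw [this.deriv_eq, deriv_const]
  -- a uniform bound for `Φ'` on `[t - δ/2, t + δ/2] × K`
  obtain ⟨M, hM⟩ : ∃ M, ∀ z ∈ Icc (t - δ / 2) (t + δ / 2) ×ˢ K, ‖uncurry Φ' z‖ ≤ M :=
    (isCompact_Icc.prod hK).exists_bound_of_continuousOn
      (hΦ'cont.mono (prod_mono hIcc (subset_univ _)))
  -- dominated differentiation
  have key := hasDerivAt_integral_of_dominated_loc_of_deriv_le (μ := μ) (F := Φ) (F' := Φ')
    (x₀ := t) (bound := K.indicator fun _ => M) hnhds ?_ ?_ ?_ ?_ ?_ ?_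
  · exact key.2
  · filter_upwards [hS.mem_nhds ht] with s hs using (hslice s hs).aestronglyMeasurable
  · exact (hslice t ht).integrable_of_hasCompactSupport (HasCompactSupport.intro hK (hsupp t ht))
  · exact (hslice' t ht).aestronglyMeasurable
  · refine Eventually.of_forall fun x s hs => ?_
    by_cases hx : x ∈ K
    · rw [indicator_of_mem hx]
      exact hM (s, x) (mk_mem_prod hs hx)
    · rw [indicator_of_notMem hx, hsupp' s (hIcc hs) x hx, norm_zero]
  · exact (integrable_indicator_iff hK.measurableSet).2
      (integrableOn_const hK.measure_lt_top.ne)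
  · refine Eventually.of_forall fun x s hs => ?_
    exact (hasDerivAt_timeLine_of_contDiffOn hS hΦ hn (hIcc hs) x).differentiableAt.hasDerivAt

end Parametric

/-! ### Integration by parts at a fixed time -/

section IBP

variable {E : Type*} [NormedAddCommGroup E] [InnerProductSpace ℝ E] [FiniteDimensional ℝ E]
  [MeasurableSpace E] [BorelSpace E]

/-- **Transport is antisymmetric against a divergence-free drift**: for `q ∈ C¹_c(E)`,
`G ∈ C¹(E)` and a `C¹` vector field `b` with `div b = 0`, `∫ q (b·∇G) = −∫ G (b·∇q)`
(apply `∫ θ div b + ∫ ⟪b, ∇θ⟫ = 0` to `θ = q G`; Leray 1934, §6 (1.11)). [cite: Leray1934, §6 (1.11) p. 203] -/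
theorem integral_mul_fderiv_apply_eq_neg_of_divergence_eq_zero {q G : E → ℝ} {b : E → E}
    (hq : ContDiff ℝ 1 q) (hG : ContDiff ℝ 1 G) (hb : ContDiff ℝ 1 b)
    (hdiv : ∀ x, VectorCalculus.divergence b x = 0) (hc : HasCompactSupport q) :
    ∫ x, q x * fderiv ℝ G x (b x) = -∫ x, G x * fderiv ℝ q x (b x) := by
  have hθ : ContDiff ℝ 1 fun x => q x * G x := hq.mul hG
  have hθc : HasCompactSupport fun x => q x * G x := hc.mono (Function.support_mul_subset_left q G)
  have key := integral_mul_divergence_add_eq_zero_left hθ hb hθc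
  have h0 : ∫ x, q x * G x * VectorCalculus.divergence b x = 0 := by
    have : (fun x => q x * G x * VectorCalculus.divergence b x) = fun _ => 0 := by
      funext x; rw [hdiv x, mul_zero]
    rw [this, integral_zero]
  rw [h0, zero_add] at key
  -- expand `⟪b, ∇(qG)⟫ = q (DG b) + G (Dq b)`
  have hqd : ∀ x, DifferentiableAt ℝ q x := fun x => hq.differentiable one_ne_zero x
  have hGd : ∀ x, DifferentiableAt ℝ G x := fun x => hG.differentiable one_ne_zero x
  have hpt : (fun x => ⟪b x, gradient (fun y => q y * G y) x⟫) =
      fun x => q x * fderiv ℝ G x (b x) + G x * fderiv ℝ q x (b x) := by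
    funext x
    rw [real_inner_comm, inner_gradient_left, fderiv_fun_mul (hqd x) (hGd x)]
    simp only [add_apply, FunLike.coe_smul, Pi.smul_apply,
      smul_eq_mul]
  rw [hpt] at key
  -- both summands are continuous with compact support
  have hi₁ : Integrable (fun x => q x * fderiv ℝ G x (b x)) (volume : Measure E) :=
    (hq.continuous.mul ((hG.continuous_fderiv one_ne_zero).clm_apply hb.continuous))
      |>.integrable_of_hasCompactSupport (hc.mono (Function.support_mul_subset_left _ _))
  have hi₂ : Integrable (fun x => G x * fderiv ℝ q x (b x)) (volume : Measure E) := by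
    refine (hG.continuous.mul ((hq.continuous_fderiv one_ne_zero).clm_apply hb.continuous))
      |>.integrable_of_hasCompactSupport ((hc.fderiv (𝕜 := ℝ)).mono fun x hx => ?_)
    contrapose! hx
    simp only [Function.mem_support, ne_eq, not_not] at hx ⊢
    simp [hx]
  rw [integral_add hi₁ hi₂] at key
  linarith

/-- **Green's second identity without boundary**: for `q ∈ C²_c(E)` and `G ∈ C²(E)`,
`∫ q ΔG = ∫ (Δq) G` (Green's first identity `∫ ⟪Δv, w⟫ + Σᵢ ∫ ⟪∂ᵢv, ∂ᵢw⟫ = 0` applied twice,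
once with the compactly supported factor on each side; Evans 2010, App. C.2 Thm 3). [folklore] -/
theorem integral_mul_laplacian_eq_integral_laplacian_mul {q G : E → ℝ} (hq : ContDiff ℝ 2 q)
    (hG : ContDiff ℝ 2 G) (hc : HasCompactSupport q) :
    ∫ x, q x * (Δ G) x = ∫ x, (Δ q) x * G x := by
  set b := stdOrthonormalBasis ℝ E
  have h1 := integral_inner_laplacian_add_eq_zero (F' := ℝ) b hG (hq.of_le one_le_two) (Or.inr hc)
  have h2 := integral_inner_laplacian_add_eq_zero (F' := ℝ) b hq (hG.of_le one_le_two) (Or.inl hc)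
  have hsum : ∑ i, ∫ x, ⟪fderiv ℝ G x (b i), fderiv ℝ q x (b i)⟫ =
      ∑ i, ∫ x, ⟪fderiv ℝ q x (b i), fderiv ℝ G x (b i)⟫ := by
    refine Finset.sum_congr rfl fun i _ => integral_congr_ae (Eventually.of_forall fun x => ?_)
    exact real_inner_comm _ _
  rw [hsum] at h1
  have h3 : ∫ x, ⟪(Δ G) x, q x⟫ = ∫ x, ⟪(Δ q) x, G x⟫ := by linarith
  have e1 : (fun x => q x * (Δ G) x) = fun x => ⟪(Δ G) x, q x⟫ := by
    funext x; rw [Real.inner_apply, mul_comm]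
  have e2 : (fun x => (Δ q) x * G x) = fun x => ⟪(Δ q) x, G x⟫ := by
    funext x; rw [Real.inner_apply]
  rw [e1, e2, h3]

end IBP

/-! ### The first variation against an adapted kernel -/

section Kernel

variable {E : Type*} [NormedAddCommGroup E] [InnerProductSpace ℝ E] [FiniteDimensional ℝ E]
  [MeasurableSpace E] [BorelSpace E]

omit [InnerProductSpace ℝ E] [FiniteDimensional ℝ E] [MeasurableSpace E] [BorelSpace E] in
/-- A slice supported in the compact set `K` has topological support in `K`. [folklore] -/
theorem tsupport_subset_of_eq_zero {f : E → ℝ} {K : Set E} (hK : IsCompact K)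
    (h : ∀ x ∉ K, f x = 0) : tsupport f ⊆ K :=
  closure_minimal (fun x hx => by by_contra hxK; exact hx (h x hxK)) hK.isClosed

omit [FiniteDimensional ℝ E] [MeasurableSpace E] [BorelSpace E] in
/-- The derivative of a slice supported in `K` vanishes off `K`. [folklore] -/
theorem fderiv_eq_zero_of_eq_zero_off {f : E → ℝ} {K : Set E} (hK : IsCompact K)
    (h : ∀ x ∉ K, f x = 0) {x : E} (hx : x ∉ K) : fderiv ℝ f x = 0 :=
  fderiv_of_notMem_tsupport ℝ fun hx' => hx (tsupport_subset_of_eq_zero hK h hx')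

omit [MeasurableSpace E] [BorelSpace E] in
/-- The Laplacian of a slice supported in `K` vanishes off `K`. [folklore] -/
theorem laplacian_eq_zero_of_eq_zero_off {f : E → ℝ} {K : Set E} (hK : IsCompact K)
    (h : ∀ x ∉ K, f x = 0) {x : E} (hx : x ∉ K) : (Δ f) x = 0 :=
  laplacian_eq_zero_of_notMem_tsupport fun hx' => hx (tsupport_subset_of_eq_zero hK h hx')

/-- **First variation against a flow-adapted backward kernel.** Let `S` be an open set of times,
`G : ℝ → E → ℝ` jointly `C²` on `S × E` and solving the adjoint equation
`∂ₜG + u·∇G + νΔG = 0` there (clauses (1) and (3) of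
`Literature.Analysis.FluidPDE.IsAdaptedBackwardKernel`), with drift slices `u(t, ·) ∈ C¹`,
`div u(t, ·) = 0`. Then for every test field `q` jointly `C²` on `S × E` whose slices are supported
in a fixed compact set `K`, and every `t ∈ S`,

  `d/dt ∫ q(t, x) G(t, x) dx = ∫ (∂ₜq + u·∇q − νΔq)(t, x) G(t, x) dx`

— transport drops out exactly (Friedman 1964, Ch. 1 §8, (8.3)–(8.5), integrated over `E` with no
boundary terms: `∂ₜ(qG) = (∂ₜq)G + q ∂ₜG = (∂ₜq)G − q(u·∇G) − ν q ΔG`, then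
`∫ q (u·∇G) = −∫ G (u·∇q)` and `∫ q ΔG = ∫ (Δq) G`). Only `C²` regularity of `G` is used, and no
bound on its derivatives. [cite: Friedman1964, Ch. 1 §8 (8.3)–(8.5)] -/
theorem hasDerivAt_integral_mul_adaptedKernel {ν : ℝ} {u : ℝ → E → E} {S : Set ℝ}
    {G q : ℝ → E → ℝ} (hS : IsOpen S) (hG : ContDiffOn ℝ 2 (uncurry G) (S ×ˢ univ))
    (hadj : ∀ t ∈ S, ∀ x,
      timeDerivWithin S G t x + fderiv ℝ (G t) x (u t x) + ν * (Δ (G t)) x = 0)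
    (hu : ∀ t ∈ S, ContDiff ℝ 1 (u t))
    (hdiv : ∀ t ∈ S, ∀ x, VectorCalculus.divergence (u t) x = 0)
    (hq : ContDiffOn ℝ 2 (uncurry q) (S ×ˢ univ)) {K : Set E} (hK : IsCompact K)
    (hsupp : ∀ t ∈ S, ∀ x ∉ K, q t x = 0) {t : ℝ} (ht : t ∈ S) :
    HasDerivAt (fun s => ∫ x, q s x * G s x)
      (∫ x, (deriv (fun s => q s x) t + fderiv ℝ (q t) x (u t x) - ν * (Δ (q t)) x) * G t x) t := by
  have h12 : (1 : WithTop ℕ∞) ≤ 2 := by norm_num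
  -- the product field is jointly `C¹` and supported in `K`
  set Φ : ℝ → E → ℝ := fun s x => q s x * G s x with hΦ
  have hΦ1 : ContDiffOn ℝ 2 (uncurry Φ) (S ×ˢ univ) := by
    have := hq.mul hG
    exact this.congr fun z _ => by obtain ⟨s, x⟩ := z; rfl
  have hΦsupp : ∀ s ∈ S, ∀ x ∉ K, Φ s x = 0 := fun s hs x hx => by
    simp only [hΦ, hsupp s hs x hx, zero_mul]
  have key := hasDerivAt_integral_of_contDiffOn_of_support_subset (μ := (volume : Measure E))
    hS hΦ1 h12 hK hΦsupp ht
  -- slice regularity at time `t`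
  have hqt : ContDiff ℝ 2 (q t) := contDiff_slice_of_contDiffOn_prod_univ hq ht
  have hGt : ContDiff ℝ 2 (G t) := contDiff_slice_of_contDiffOn_prod_univ hG ht
  have hqt1 : ContDiff ℝ 1 (q t) := hqt.of_le one_le_two
  have hGt1 : ContDiff ℝ 1 (G t) := hGt.of_le one_le_two
  have hut := hu t ht
  have hqc : HasCompactSupport (q t) := HasCompactSupport.intro hK (hsupp t ht)
  -- time derivatives of the lines
  set q' : E → ℝ := fun x => deriv (fun s => q s x) t with hq'
  set G' : E → ℝ := fun x => deriv (fun s => G s x) t with hG'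
  have hqd : ∀ x, HasDerivAt (fun s => q s x) (q' x) t := fun x =>
    (hasDerivAt_timeLine_of_contDiffOn hS hq h12 ht x).differentiableAt.hasDerivAt
  have hGd : ∀ x, HasDerivAt (fun s => G s x) (G' x) t := fun x =>
    (hasDerivAt_timeLine_of_contDiffOn hS hG h12 ht x).differentiableAt.hasDerivAt
  -- the adjoint equation with the two-sided time derivative
  have hG'eq : ∀ x, G' x = -(fderiv ℝ (G t) x (u t x)) - ν * (Δ (G t)) x := fun x => by
    have h := hadj t ht x
    rw [timeDerivWithin_eq_deriv hS ht] at h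
    rw [hG']; dsimp only
    linarith
  -- the pointwise derivative of the product
  have hderiv : ∀ x, deriv (fun s => Φ s x) t =
      q' x * G t x + q t x * (-(fderiv ℝ (G t) x (u t x)) - ν * (Δ (G t)) x) := fun x => by
    rw [show (fun s => Φ s x) = (fun s => q s x) * fun s => G s x from rfl,
      ((hqd x).mul (hGd x)).deriv, hG'eq x]
  -- continuity and support of the ingredients
  have hq'c : Continuous q' :=
    continuous_slice_of_continuousOn_prod_univ (continuousOn_deriv_timeLine_of_contDiffOn hS hq h12) ht
  have hq's : ∀ x ∉ K, q' x = 0 := fun x hx => by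
    have : (fun r => q r x) =ᶠ[𝓝 t] fun _ => (0 : ℝ) := by
      filter_upwards [hS.mem_nhds ht] with r hr using hsupp r hr x hx
    show deriv (fun r => q r x) t = 0
    rw [this.deriv_eq, deriv_const]
  have hq'cs : HasCompactSupport q' := HasCompactSupport.intro hK hq's
  have hDq0 : ∀ x ∉ K, fderiv ℝ (q t) x = 0 := fun x hx =>
    fderiv_eq_zero_of_eq_zero_off hK (hsupp t ht) hx
  have hΔq0 : ∀ x ∉ K, (Δ (q t)) x = 0 := fun x hx =>
    laplacian_eq_zero_of_eq_zero_off hK (hsupp t ht) hx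
  have hGc : Continuous (G t) := hGt.continuous
  have hDGu : Continuous fun x => fderiv ℝ (G t) x (u t x) :=
    (hGt1.continuous_fderiv one_ne_zero).clm_apply hut.continuous
  have hDqu : Continuous fun x => fderiv ℝ (q t) x (u t x) :=
    (hqt1.continuous_fderiv one_ne_zero).clm_apply hut.continuous
  have hΔG : Continuous (Δ (G t)) := continuous_laplacian hGt
  have hΔq : Continuous (Δ (q t)) := continuous_laplacian hqt
  -- integrability of the four pieces
  have i₁ : Integrable (fun x => q' x * G t x) (volume : Measure E) :=
    (hq'c.mul hGc).integrable_of_hasCompactSupport (hq'cs.mono (Function.support_mul_subset_left _ _))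
  have i₂ : Integrable (fun x => q t x * fderiv ℝ (G t) x (u t x)) (volume : Measure E) :=
    (hqt.continuous.mul hDGu).integrable_of_hasCompactSupport
      (hqc.mono (Function.support_mul_subset_left _ _))
  have i₃ : Integrable (fun x => q t x * (Δ (G t)) x) (volume : Measure E) :=
    (hqt.continuous.mul hΔG).integrable_of_hasCompactSupport
      (hqc.mono (Function.support_mul_subset_left _ _))
  have i₄ : Integrable (fun x => fderiv ℝ (q t) x (u t x) * G t x) (volume : Measure E) := by
    refine (hDqu.mul hGc).integrable_of_hasCompactSupport (HasCompactSupport.intro hK fun x hx => ?_)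
    simp [hDq0 x hx]
  have i₅ : Integrable (fun x => (Δ (q t)) x * G t x) (volume : Measure E) := by
    refine (hΔq.mul hGc).integrable_of_hasCompactSupport (HasCompactSupport.intro hK fun x hx => ?_)
    simp [hΔq0 x hx]
  -- the two integrations by parts
  have ibp₁ : ∫ x, q t x * fderiv ℝ (G t) x (u t x) = -∫ x, G t x * fderiv ℝ (q t) x (u t x) :=
    integral_mul_fderiv_apply_eq_neg_of_divergence_eq_zero hqt1 hGt1 hut (hdiv t ht) hqc
  have ibp₂ : ∫ x, q t x * (Δ (G t)) x = ∫ x, (Δ (q t)) x * G t x :=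
    integral_mul_laplacian_eq_integral_laplacian_mul hqt hGt hqc
  -- assemble
  have hL : ∫ x, deriv (fun s => Φ s x) t =
      (∫ x, q' x * G t x) - (∫ x, q t x * fderiv ℝ (G t) x (u t x)) -
        ν * ∫ x, q t x * (Δ (G t)) x := by
    have e : (fun x => deriv (fun s => Φ s x) t) =
        fun x => q' x * G t x - q t x * fderiv ℝ (G t) x (u t x) - ν * (q t x * (Δ (G t)) x) := by
      funext x; rw [hderiv x]; ring
    have i₁₂ : Integrable (fun x => q' x * G t x - q t x * fderiv ℝ (G t) x (u t x))
        (volume : Measure E) := i₁.sub i₂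
    have i₃' : Integrable (fun x => ν * (q t x * (Δ (G t)) x)) (volume : Measure E) := i₃.const_mul ν
    rw [e, integral_sub i₁₂ i₃', integral_sub i₁ i₂, integral_const_mul]
  have hR : ∫ x, (q' x + fderiv ℝ (q t) x (u t x) - ν * (Δ (q t)) x) * G t x =
      (∫ x, q' x * G t x) + (∫ x, fderiv ℝ (q t) x (u t x) * G t x) -
        ν * ∫ x, (Δ (q t)) x * G t x := by
    have e : (fun x => (q' x + fderiv ℝ (q t) x (u t x) - ν * (Δ (q t)) x) * G t x) =
        fun x => q' x * G t x + fderiv ℝ (q t) x (u t x) * G t x - ν * ((Δ (q t)) x * G t x) := by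
      funext x; ring
    have i₁₄ : Integrable (fun x => q' x * G t x + fderiv ℝ (q t) x (u t x) * G t x)
        (volume : Measure E) := i₁.add i₄
    have i₅' : Integrable (fun x => ν * ((Δ (q t)) x * G t x)) (volume : Measure E) := i₅.const_mul ν
    rw [e, integral_sub i₁₄ i₅', integral_add i₁ i₄, integral_const_mul]
  have hmid : (∫ x, fderiv ℝ (q t) x (u t x) * G t x) = ∫ x, G t x * fderiv ℝ (q t) x (u t x) :=
    integral_congr_ae (Eventually.of_forall fun x => mul_comm _ _)
  have heq : ∫ x, deriv (fun s => Φ s x) t =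
      ∫ x, (q' x + fderiv ℝ (q t) x (u t x) - ν * (Δ (q t)) x) * G t x := by
    rw [hL, hR, ibp₁, ibp₂, hmid]; ring
  rw [← heq]
  exact key

/-- The same for an adapted kernel packaged as `IsAdaptedBackwardKernel` on an open time set, for
a drift with `C¹` divergence-free slices. [folklore] -/
theorem hasDerivAt_integral_mul_of_isAdaptedBackwardKernel {ν : ℝ} {u : ℝ → E → E} {S : Set ℝ}
    {T : ℝ} {x₀ : E} {G q : ℝ → E → ℝ} (hGk : IsAdaptedBackwardKernel ν u S T x₀ G)
    (hS : IsOpen S) (hu : ∀ t ∈ S, ContDiff ℝ 1 (u t))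
    (hdiv : ∀ t ∈ S, ∀ x, VectorCalculus.divergence (u t) x = 0)
    (hq : ContDiffOn ℝ 2 (uncurry q) (S ×ˢ univ)) {K : Set E} (hK : IsCompact K)
    (hsupp : ∀ t ∈ S, ∀ x ∉ K, q t x = 0) {t : ℝ} (ht : t ∈ S) :
    HasDerivAt (fun s => ∫ x, q s x * G s x)
      (∫ x, (deriv (fun s => q s x) t + fderiv ℝ (q t) x (u t x) - ν * (Δ (q t)) x) * G t x) t :=
  hasDerivAt_integral_mul_adaptedKernel hS hGk.contDiffOn hGk.adjoint_eq hu hdiv hq hK hsupp ht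

end Kernel

end Summit.NavierStokesRegularity.NavierStokesRegularity.Theorems

end
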